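import Literature.MathematicalPhysics.QuantumLattice.HubbardThermalNoFiniteMomentumLRO
import Literature.MathematicalPhysics.QuantumLattice.HeisenbergOrderMerminWagnerHeisenbergProofs
import HarnessLib

/-!
# Mermin–Wagner 1966 at an arbitrary ordering wavevector: the thermal spin structure factor of the
# nearest-neighbour Heisenberg model in `d ≤ 2` is `o(L^d)` at every momentum

Topic `MathematicalPhysics/QuantumLattice`; sibling PROOF file of `HeisenbergOrder.lean` /
`HeisenbergOrderMerminWagnerHeisenbergProofs.lean` (`mermin_wagner_holds`: no uniform order,
`mermin_wagner_staggered_holds`: no Néel order). Mermin–Wagner's theorem is stated for the sublattice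
magnetisation `s_z(𝐊)` at an ARBITRARY wavevector `𝐊` (ferromagnetic `𝐊 = 0`, antiferromagnetic
`𝐊 = (π,…,π)`, or any other periodic arrangement); the tree had the two commensurate cases. Combining
the uniform power-law decay of `⟨𝐒_x·𝐒_y⟩_{β,L}` (`MerminWagner.exists_abs_spinSpinCorrTorus_le_rpow`,
Koma–Tasaki's note [11]) with the weighted summation lemma
`tendsto_weightedCorrSum_div_of_abs_le_rpow` gives the wavevector-blind form:

* `heisenberg_thermal_spinCorr_weightedSum_tendsto_zero` — `d ∈ {1, 2}`, every spin `n/2`, `J`, `β > 0`,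
  all weights `|w_L(x,y)| ≤ 1`: `L^{-2d} Σ_{x,y} w_L(x,y) ⟨𝐒_x·𝐒_y⟩_{β,L} → 0`;
* `heisenberg_thermal_spinStructureFactor_tendsto_zero` — for every choice of momenta `k_L ∈ (ℤ/Lℤ)^d`:
  `L^{-2d} Σ_{x,y} cos(k_L·(x-y)) ⟨𝐒_x·𝐒_y⟩_{β,L} → 0` (no magnetic Bragg peak at any, possibly
  incommensurate or `L`-dependent, wavevector: no ferro-, antiferro-, spiral or stripe order at `T > 0`).

Theorems only: no definition, no named fact, no statement of the tree is changed.
HONEST FRAMING (cell pub-hubbard): ladder R1–R4 with certified numbers; no claim on H/H₀.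

## References

* [MerminWagnerPRL1966] N. D. Mermin, H. Wagner, PRL **17** (1966) 1133–1136 — the bound on
  `s_z(𝐊)` for arbitrary `𝐊`, pp. 1133–1135.
* [KomaTasakiPRL1992] T. Koma, H. Tasaki, PRL **68** (1992) 3248, Theorem eq. (4), note [11] and the
  remark after the Theorem (arXiv:cond-mat/9709068 p. 3).
-/

noncomputable section

namespace Literature.MathematicalPhysics.QuantumLattice

open Filter Topology Literature.Probability.LatticeModels

variable {d : ℕ}

/-- **No weighted spin order at `T > 0` in `d ≤ 2`** (nearest-neighbour Heisenberg model, every spin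
`n/2`, every `J`, `β > 0`): for all weights `|w_L(x,y)| ≤ 1`,
`L^{-2d} Σ_{x,y ∈ (ℤ/Lℤ)^d} w_L(x,y) ⟨𝐒_x·𝐒_y⟩_{β,L} → 0` (indexed by `L + 1`). From the uniform power-law
decay `MerminWagner.exists_abs_spinSpinCorrTorus_le_rpow` and
`tendsto_weightedCorrSum_div_of_abs_le_rpow`. [cite: MerminWagnerPRL1966, main result (pp. 1133–1135)]
[cite: KomaTasakiPRL1992, Theorem eq. (4), note [11] and remark after the Theorem] -/
theorem heisenberg_thermal_spinCorr_weightedSum_tendsto_zero (hd1 : 1 ≤ d) (hd2 : d ≤ 2) (n : ℕ)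
    (J : ℝ) {β : ℝ} (hβ : 0 < β) {w : (L : ℕ) → TorusSite d L → TorusSite d L → ℝ}
    (hw : ∀ (L : ℕ) [NeZero L] (x y : TorusSite d L), |w L x y| ≤ 1) :
    Tendsto (fun L : ℕ => (∑ x : TorusSite d (L + 1), ∑ y : TorusSite d (L + 1),
        w (L + 1) x y * spinSpinCorrTorus (d := d) β (L + 1) n J x y) / ((L + 1 : ℕ) : ℝ) ^ (2 * d))
      atTop (𝓝 0) := by
  obtain ⟨f, hf, C', hC'⟩ := MerminWagner.exists_abs_spinSpinCorrTorus_le_rpow (d := d) hd1 hd2 n J hβ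
  exact tendsto_weightedCorrSum_div_of_abs_le_rpow (by omega)
    (G := fun L x y => spinSpinCorrTorus (d := d) β L n J x y) (w := w) (C := C') hf
    (fun L _ x y => hC' L x y) hw

/-- **Mermin–Wagner at every wavevector**: for `d ∈ {1, 2}`, every spin `n/2`, `J`, `β > 0` and every
choice of momenta `k_L ∈ (ℤ/Lℤ)^d` (constant, `(π,…,π)`, incommensurate, `L`-dependent …), the thermal
spin structure factor per site vanishes: `L^{-2d} Σ_{x,y} cos(k_L·(x-y)) ⟨𝐒_x·𝐒_y⟩_{β,L} → 0` — no
ferromagnetic, antiferromagnetic, spiral or otherwise modulated magnetic long-range order at `T > 0`.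
[cite: MerminWagnerPRL1966, main result (pp. 1133–1135)]
[cite: KomaTasakiPRL1992, Theorem eq. (4), note [11] and remark after the Theorem] -/
theorem heisenberg_thermal_spinStructureFactor_tendsto_zero (hd1 : 1 ≤ d) (hd2 : d ≤ 2) (n : ℕ)
    (J : ℝ) {β : ℝ} (hβ : 0 < β) (k : (L : ℕ) → TorusSite d L) :
    Tendsto (fun L : ℕ => (∑ x : TorusSite d (L + 1), ∑ y : TorusSite d (L + 1),
        Real.cos (torusPhase (L + 1) (k (L + 1)) (x - y)) * spinSpinCorrTorus (d := d) β (L + 1) n J x y) /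
          ((L + 1 : ℕ) : ℝ) ^ (2 * d)) atTop (𝓝 0) :=
  heisenberg_thermal_spinCorr_weightedSum_tendsto_zero hd1 hd2 n J hβ
    (w := fun L x y => Real.cos (torusPhase L (k L) (x - y))) fun _ _ _ _ => Real.abs_cos_le_one _

end Literature.MathematicalPhysics.QuantumLattice
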